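import Literature.AlgebraicGeometry.Frobenioids.RigiditySlimness
import Literature.AlgebraicGeometry.Frobenioids.UnitTrivialisationRigidity
import Literature.AlgebraicGeometry.Frobenioids.DivisorMonoidCategoryTheoreticityDefs
import Literature.AlgebraicGeometry.Frobenioids.PreFrobenioidDataOfFunctor
import Literature.AlgebraicGeometry.Frobenioids.BaseSquareUniqueness
import HarnessLib

/-!
# Frobenioids I, Theorem 3.4 (iv), (v) — the rigidity clauses "each of the composite functors of this
# diagram is rigid" for the `C^istr/C^un-tr` square and the `C/D` square, over SLIM bases

Mochizuki, *The geometry of Frobenioids I: the general theory*, Kyushu J. Math. **62** (2008)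
293–400, kurims text Thm. 3.4 (iv) p. 63 ll. 20–21 ("Finally, if `D₁, D₂` are slim, then each of the
composite functors of this diagram is rigid", the diagram being the `C^istr → C^un-tr` square) with its
proof p. 66 ll. 39–41 ("since `C^un-tr_1`, `C^un-tr_2` are of unit-trivial type, the asserted rigidity
follows formally from Proposition 1.13, (ii)"), and Thm. 3.4 (v) p. 63 ll. 36–37 ("Finally, each of the
composite functors of this diagram is rigid", the `C → D` square) with its proof p. 69 ll. 20–26 ("the
asserted rigidity follows formally from Proposition 1.13, (i)") [cite: MochizukiFrdI2008, Thm. 3.4 (v) p.63].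

PROOF-ONLY companion (seat abc-iut-w4-d090; sub-DAG `plan/L1/SUBDAG-FrdI-Thm34.md` rows
`FrdI:Thm3.4(v)/L14 BaseRigidity` and `FrdI:Thm3.4(iv)/L11 UntrRigidity`) of the typed statements
`PreFrobenioidData.Thm34v` / `PreFrobenioidData.Thm34iv_untr` (`BaseCategoryTheoreticity.lean`, seat
abc-iut-L1-t3), for Frobenioids in found's vocabulary (`F : C ⥤ ElemFrobenioid Φ`, `IsFrobenioid F`,
operations `PreFrobenioidData.ofFunctor Φ F`), in EXACTLY the hypothesis shapes the landed reductions
consume: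

* `isRigidFunctor_equivalence_comp_base` — `C₁ ⥲ C₂ → D₂` is rigid for `D₂` slim (Prop. 1.13 (i)
  `isRigidFunctor_baseFunctor`, precomposed with the equivalence `Ψ`): the `hrig` input of
  `BaseSquareUniqueness.cor411ii_of_exists_base_equivalence` and the first rigidity conjunct of the typed
  `Thm34v` / `Prop311iii`;
* `isRigidFunctor_base_comp_of_oneCommutes`, `thm34v_rigidity` — the second conjunct
  `IsRigidFunctor (Base₁ ⋙ Ψ^Base)` by transport along the `1`-commutativity isomorphism
  `Ψ ⋙ Base₂ ≅ Base₁ ⋙ Ψ^Base`, for ANY `Ψ^Base` making the square `1`-commute (row L14);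
* `isRigidFunctor_toUntr_of_isSlim`, `isRigidFunctor_comp_toUntr_of_isSlim` — `C^istr → C^un-tr` and
  `C₁' ⥲ C^istr → C^un-tr` are rigid for `D` SLIM: "every slim category is Div-slim" (Def. 4.5 (iv),
  `isDivSlim_of_isSlim`) feeds the Div-slim rigidity `isRigidFunctor_toUntr` of
  `UnitTrivialisationRigidity.lean` (which is the Cor. 4.11 (i) form of the same argument); this is the
  `hrig` input of `UnitTrivialisationFunctoriality.thm34iv_untr_of_units`;
* `thm34iv_untr_rigidity` — both conjuncts for the `C^istr/C^un-tr` square, for ANY `Ψ^un-tr` making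
  the square `1`-commute (row L11).

No statement of the paper is restated or strengthened; HONEST FRAMING: [FrdI] is a refereed, undisputed
paper; nothing here bears on [IUTchIII] Cor. 3.12 beyond supplying kernel-checked inputs by name.
-/

namespace Literature.AlgebraicGeometry.Frobenioids

open CategoryTheory Opposite

universe w v v' u u' v₁ u₁ v₂ u₂

namespace PreFrobenioid

/-! ### Theorem 3.4 (v): the composites of the `C/D` square -/

section BaseSquare

variable {D₁ : Type u} [Category.{v} D₁] {D₂ : Type u} [Category.{v} D₂] {Φ₂ : D₂ᵒᵖ ⥤ CommMonCat.{w}}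
  {C₁ : Type u'} [Category.{v'} C₁] {C₂ : Type u'} [Category.{v'} C₂] {F₂ : C₂ ⥤ ElemFrobenioid Φ₂}

/-- **Thm. 3.4 (v), rigidity, first composite**: for a Frobenioid `C₂ → F_{Φ₂}` over a slim base `D₂`
and any equivalence `Ψ : C₁ ⥲ C₂`, the composite `C₁ → C₂ → D₂` is rigid ("follows formally from
Proposition 1.13, (i)", FrdI p. 69). [cite: MochizukiFrdI2008, Thm. 3.4 (v) p.63] -/
theorem isRigidFunctor_equivalence_comp_base (hF₂ : IsFrobenioid F₂) (hD₂ : IsSlim D₂) (Ψ : C₁ ≌ C₂) :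
    IsRigidFunctor (Ψ.functor ⋙ (PreFrobenioidData.ofFunctor Φ₂ F₂).base) :=
  IsRigidFunctor.equivalence_comp Ψ (isRigidFunctor_baseFunctor hF₂ hD₂)

/-- **Thm. 3.4 (v), rigidity, second composite**: if `Ψ ⋙ Base₂` is rigid and the square
`Ψ ⋙ Base₂ ≅ Base₁ ⋙ Ψ^Base` `1`-commutes, then `Base₁ ⋙ Ψ^Base` is rigid (rigidity is invariant under
isomorphism of functors). [cite: MochizukiFrdI2008, Thm. 3.4 (v) p.63] -/
theorem isRigidFunctor_base_comp_of_oneCommutes {S₁ : PreFrobenioidData.{w} C₁ D₁}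
    {S₂ : PreFrobenioidData.{w} C₂ D₂} (Ψ : C₁ ≌ C₂) (ΨBase : D₁ ⥤ D₂)
    (hsq : OneCommutes Ψ.functor S₂.base S₁.base ΨBase) (h : IsRigidFunctor (Ψ.functor ⋙ S₂.base)) :
    IsRigidFunctor (S₁.base ⋙ ΨBase) := by
  obtain ⟨η⟩ := hsq
  exact PreFrobenioidData.isRigidFunctor_congr η h

/-- **Thm. 3.4 (v), "Finally, each of the composite functors of this diagram is rigid"** (sub-DAG row
`FrdI:Thm3.4(v)/L14 BaseRigidity`): for a Frobenioid `C₂ → F_{Φ₂}` over a slim `D₂`, an equivalence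
`Ψ : C₁ ⥲ C₂` and ANY `Ψ^Base : D₁ → D₂` `1`-commuting with `Ψ` over `Base₁`, `Base₂`, both composites
`C₁ → C₂ → D₂` and `C₁ → D₁ → D₂` are rigid — the rigidity conjunct of the typed `Thm34v` in the shape it
is stated there. [cite: MochizukiFrdI2008, Thm. 3.4 (v) p.63] -/
theorem thm34v_rigidity (hF₂ : IsFrobenioid F₂) (hD₂ : IsSlim D₂) {S₁ : PreFrobenioidData.{w} C₁ D₁}
    (Ψ : C₁ ≌ C₂) (ΨBase : D₁ ⥤ D₂)
    (hsq : OneCommutes Ψ.functor (PreFrobenioidData.ofFunctor Φ₂ F₂).base S₁.base ΨBase) :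
    IsRigidFunctor (Ψ.functor ⋙ (PreFrobenioidData.ofFunctor Φ₂ F₂).base) ∧
      IsRigidFunctor (S₁.base ⋙ ΨBase) :=
  ⟨isRigidFunctor_equivalence_comp_base hF₂ hD₂ Ψ,
    isRigidFunctor_base_comp_of_oneCommutes Ψ ΨBase hsq (isRigidFunctor_equivalence_comp_base hF₂ hD₂ Ψ)⟩

end BaseSquare

/-! ### Theorem 3.4 (iv): the composites of the `C^istr/C^un-tr` square -/

section UntrSquare

variable {D : Type u} [Category.{v} D] {Φ : Dᵒᵖ ⥤ CommMonCat.{w}}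
  {C : Type u'} [Category.{v'} C] {F : C ⥤ ElemFrobenioid Φ}

/-- **`C^istr → C^un-tr` is rigid over a SLIM base** (FrdI proof of Thm. 3.4 (iv) p. 66: "since
`C^un-tr` [is] of unit-trivial type, the asserted rigidity follows formally from Proposition 1.13, (ii)"):
a slim base is Div-slim (Def. 4.5 (iv)), and over a Div-slim base the functor is rigid
(`isRigidFunctor_toUntr`, the Cor. 4.11 (i) rendering of this argument).
[cite: MochizukiFrdI2008, Thm. 3.4 (iv) p.63] -/
theorem isRigidFunctor_toUntr_of_isSlim (hF : IsFrobenioid F) (hD : IsSlim D) :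
    IsRigidFunctor (PreFrobenioidData.ofFunctor Φ F).toUntr :=
  isRigidFunctor_toUntr hF ((PreFrobenioidData.ofFunctor Φ F).isDivSlim_of_isSlim hD)

variable {C₁ : Type u₁} [Category.{v₁} C₁]

/-- Hence `T ⋙ (C^istr → C^un-tr)` is rigid for every equivalence `T : C₁' ⥲ C^istr` over a slim base —
the `hrig` input of `UnitTrivialisationFunctoriality.thm34iv_untr_of_units`.
[cite: MochizukiFrdI2008, Thm. 3.4 (iv) p.63] -/
theorem isRigidFunctor_comp_toUntr_of_isSlim (hF : IsFrobenioid F) (hD : IsSlim D)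
    (T : C₁ ⥤ (PreFrobenioidData.ofFunctor Φ F).Istr) [T.IsEquivalence] :
    IsRigidFunctor (T ⋙ (PreFrobenioidData.ofFunctor Φ F).toUntr) :=
  IsRigidFunctor.comp_of_isEquivalence T (isRigidFunctor_toUntr_of_isSlim hF hD)

variable {D₁ : Type u₂} [Category.{v₂} D₁] {S₁ : PreFrobenioidData.{w} C₁ D₁}

/-- **Thm. 3.4 (iv), "Finally, if `D₁, D₂` are slim, then each of the composite functors of this
diagram is rigid"** (sub-DAG row `FrdI:Thm3.4(iv)/L11 UntrRigidity`): for a Frobenioid `C₂ → F_{Φ₂}`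
over a slim `D₂`, an equivalence `Ψ^istr : C₁^istr ⥲ C₂^istr` and ANY `Ψ^un-tr : C₁^un-tr → C₂^un-tr`
`1`-commuting with `Ψ^istr` over the natural functors `C_i^istr → C_i^un-tr`, both composites
`C₁^istr → C₂^istr → C₂^un-tr` and `C₁^istr → C₁^un-tr → C₂^un-tr` are rigid — the rigidity conjunct of
the typed `Thm34iv_untr` in the shape it is stated there. [cite: MochizukiFrdI2008, Thm. 3.4 (iv) p.63] -/
theorem thm34iv_untr_rigidity (hF : IsFrobenioid F) (hD : IsSlim D)
    (Ψistr : S₁.Istr ⥤ (PreFrobenioidData.ofFunctor Φ F).Istr) [Ψistr.IsEquivalence]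
    (Ψuntr : S₁.Untr ⥤ (PreFrobenioidData.ofFunctor Φ F).Untr)
    (hsq : OneCommutes Ψistr (PreFrobenioidData.ofFunctor Φ F).toUntr S₁.toUntr Ψuntr) :
    IsRigidFunctor (Ψistr ⋙ (PreFrobenioidData.ofFunctor Φ F).toUntr) ∧
      IsRigidFunctor (S₁.toUntr ⋙ Ψuntr) := by
  obtain ⟨η⟩ := hsq
  exact ⟨isRigidFunctor_comp_toUntr_of_isSlim hF hD Ψistr,
    PreFrobenioidData.isRigidFunctor_congr η (isRigidFunctor_comp_toUntr_of_isSlim hF hD Ψistr)⟩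

end UntrSquare

end PreFrobenioid

end Literature.AlgebraicGeometry.Frobenioids
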